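import Literature.Analysis.FluidPDE.LeiZhang2011OscillationStep
import Literature.Analysis.FluidPDE.LeiZhang2011Setting
import Literature.Analysis.FluidPDE.OscillationDecayLiouville
import Literature.Analysis.FluidPDE.KNSSSwirlLiouville
import Literature.Analysis.FluidPDE.AxisymWeights
import HarnessLib

/-!
# Lei–Zhang 2011, Theorem 1.2: the discharge of `LeiZhang2011_liouville`

Analysis/FluidPDE proofs file (theorems only): the last steps of the proof of the named fact
`Literature.Analysis.FluidPDE.LeiZhang2011_liouville` (Z. Lei, Q. S. Zhang, *A Liouville
theorem for the axially-symmetric Navier–Stokes equations*, J. Funct. Anal. 261 (2011) =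
arXiv:1011.5066, Theorem 1.2).

* `bundle_of_swirl_setting` — a solution `Γ` of the swirl equation on `(−∞, 0) × ℝ³` in the
  sense of KNSS 2009, (5.10) (smooth axisymmetric slices vanishing on the axis, jointly
  continuous `Γ`, `∇Γ`, `ΔΓ`, bounded measurable drift `u = curl B` with `‖B(t)‖_BMO ≤ C_B`)
  restricts, for every apex `τ < 0` and radius `R`, to the "setting at radius `R`" consumed by
  §§2–3 in the tree (`oscillation_step`), after the time shift `s ↦ s + τ`;
* `swirl_setting_eq_zero` — step 1 of the printed proof of Theorem 1.2 (p. 12): iterating the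
  oscillation estimate (3.8) (`oscillation_step`) over the cylinders `Q_τ(R)`, `R → ∞`
  (`eq_zero_of_forall_le_mul_of_bounded`), the bounded `Γ` is constant on every cylinder, hence
  `Γ ≡ Γ|_{axis} = 0`;
* `LeiZhang2011_liouville_holds` — **Theorem 1.2**: the smooth setting `exists_setting`
  (KNSS 2009, §4 with (5.10)), `swirl_setting_eq_zero`, and steps 2–3 of the printed proof
  (`LeiZhang2011_liouville_of_swirl_step`: swirl-free ⇒ `u = −b(t)e_z` by KNSS Thm. 5.2
  ⇒ `u ≡ 0` by the `BMO` stream function).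

## References

* Z. Lei, Q. S. Zhang, J. Funct. Anal. 261 (2011) = arXiv:1011.5066, Thm. 1.2 and its proof,
  p. 12; (3.8) p. 12. [LeiZhang2011]
* G. Koch, N. Nadirashvili, G. Seregin, V. Šverák, Acta Math. 203 (2009), §4 and (5.10).
  [KochNadirashviliSereginSverak2009]
-/

noncomputable section

open MeasureTheory Set Function Filter Metric intervalIntegral InnerProductSpace
open _root_.Topology
open scoped InnerProductSpace RealInnerProductSpace NNReal ENNReal Laplacian

namespace Literature.Analysis.FluidPDE

namespace LeiZhang2011

open Literature.Analysis.FunctionSpaces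

/-! ### From the swirl setting on `(−∞, 0) × ℝ³` to the setting at radius `R` with apex `τ` -/

set_option maxHeartbeats 1600000 in
-- one long bookkeeping proof (time shift and clamp, a.e. translation, the integrated equation
-- off the axis, joint continuity/measurability, integrability against `1 + 1/r`)
/-- **The setting at radius `R` with apex `τ < 0` from the swirl setting.** Let `Γ, u, B` be as
in step 1 of the proof of Theorem 1.2 (the output of `exists_setting`: `Γ(t,·) ∈ C²` axisymmetric
vanishing on the axis with `Γ`, `∇Γ`, `ΔΓ` jointly continuous on `(−∞,0) × ℝ³`, a bounded jointly
measurable drift `u` with continuous slices, `u(t) = curl B(t)` a.e. with `‖B(t)‖_BMO ≤ C_B` for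
a.e. `t < 0`, and the swirl equation (5.10) of KNSS 2009 off the axis in time-integrated form).
Then for every `τ < 0` and `R > 0` the shifted function `F(s, x) = Γ(s + τ, x)` (`s ≤ 0`) is in the
setting at radius `R` of `oscillation_step` (with `N = ΔF − DF[u] − (2/r)∂ᵣF`, the drift
`u(· + τ)` and the stream function `B(· + τ)`). [cite: LeiZhang2011, proof of Thm. 1.2, step 1 (arXiv p. 12); KochNadirashviliSereginSverak2009, (5.10)] -/
theorem bundle_of_swirl_setting
    {f : ℝ → EuclideanSpace ℝ (Fin 3) → ℝ} {u : ℝ → EuclideanSpace ℝ (Fin 3) → EuclideanSpace ℝ (Fin 3)}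
    (h1 : ∀ t < 0, ContDiff ℝ 2 (f t))
    (hfc : ContinuousOn (fun p : ℝ × EuclideanSpace ℝ (Fin 3) => f p.1 p.2) (Iio 0 ×ˢ univ))
    (h2 : ContinuousOn (fun p : ℝ × EuclideanSpace ℝ (Fin 3) => fderiv ℝ (f p.1) p.2) (Iio 0 ×ˢ univ))
    (h3 : ContinuousOn (fun p : ℝ × EuclideanSpace ℝ (Fin 3) => (Δ (f p.1)) p.2) (Iio 0 ×ˢ univ))
    (h4 : ∀ t < 0, IsAxisymmetricScalar (f t))
    (h5 : ∀ t < 0, ∀ x, cylRadius x = 0 → f t x = 0)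
    (h7 : Measurable (uncurry u)) (h8 : ∀ t < 0, Continuous (u t))
    {Cu : ℝ} (hub : ∀ t < 0, ∀ x, ‖u t x‖ ≤ Cu)
    {B : ℝ → EuclideanSpace ℝ (Fin 3) → EuclideanSpace ℝ (Fin 3)} {CB : ℝ≥0}
    (hB : ∀ᵐ t ∂((volume : Measure ℝ).restrict (Iio 0)),
      Differentiable ℝ (B t) ∧ curl (B t) =ᵐ[volume] u t ∧ eBMOSeminormVec (B t) ≤ CB)
    (h11 : ∀ x, cylRadius x ≠ 0 → ∀ s t : ℝ, s ≤ t → t < 0 →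
      f t x - f s x = ∫ τ in s..t, ((Δ (f τ)) x - fderiv ℝ (f τ) x (u τ x) -
        2 / cylRadius x * partialDeriv (eR x) (f τ) x))
    {τ : ℝ} (hτ : τ < 0) {R : ℝ} (hR : 0 < R) :
    ∃ (F N : ℝ → EuclideanSpace ℝ (Fin 3) → ℝ)
      (b Bst : ℝ → EuclideanSpace ℝ (Fin 3) → EuclideanSpace ℝ (Fin 3)) (Mb : ℝ),
      (∀ s ≤ 0, ∀ x, F s x = f (s + τ) x) ∧
      (∀ s, ContDiff ℝ 2 (F s)) ∧ (∀ s, IsAxisymmetricScalar (F s)) ∧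
      (∀ s x, cylRadius x = 0 → F s x = 0) ∧
      (∀ s, LocallyIntegrable (b s) volume) ∧
      (∀ᵐ s ∂(volume.restrict (Ioc (-R ^ 2) 0)),
        Differentiable ℝ (Bst s) ∧ curl (Bst s) =ᵐ[volume] b s ∧ eBMOSeminormVec (Bst s) ≤ CB) ∧
      (∀ s x, N s x =
        (Δ (F s)) x - fderiv ℝ (F s) x (b s x) - 2 / cylRadius x * fderiv ℝ (F s) x (eR x)) ∧
      (∀ᵐ x ∂(volume : Measure (EuclideanSpace ℝ (Fin 3))),
        IntervalIntegrable (fun s => N s x) volume (-R ^ 2) 0 ∧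
          ∀ s ∈ Icc (-R ^ 2) 0, F s x = F (-R ^ 2) x + ∫ σ in (-R ^ 2)..s, N σ x) ∧
      (Continuous fun p : ℝ × EuclideanSpace ℝ (Fin 3) => F p.1 p.2) ∧
      (Continuous fun p : ℝ × EuclideanSpace ℝ (Fin 3) => gradient (F p.1) p.2) ∧
      AEStronglyMeasurable (fun p : ℝ × EuclideanSpace ℝ (Fin 3) => N p.1 p.2)
        ((volume.restrict (Ioc (-R ^ 2) 0)).prod volume) ∧
      Integrable (fun p : ℝ × EuclideanSpace ℝ (Fin 3) => N p.1 p.2)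
        ((volume.restrict (Ioc (-R ^ 2) 0)).prod (volume.restrict (closedBall 0 R))) ∧
      AEStronglyMeasurable (fun p : ℝ × EuclideanSpace ℝ (Fin 3) => b p.1 p.2)
        ((volume.restrict (Ioc (-R ^ 2) 0)).prod volume) ∧
      (∀ s, ∀ x ∈ closedBall (0 : EuclideanSpace ℝ (Fin 3)) R, ‖b s x‖ ≤ Mb) := by
  -- the clamped time shift `c(s) = τ + min(s, 0) < 0`, `c(s) = s + τ` for `s ≤ 0` (opaque names)
  obtain ⟨c, hcdef⟩ : ∃ c : ℝ → ℝ, ∀ s, c s = τ + min s 0 := ⟨_, fun _ => rfl⟩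
  have hcc : Continuous c := by
    have e : c = fun s => τ + min s 0 := funext hcdef
    rw [e]; exact continuous_const.add (continuous_id.min continuous_const)
  have hcneg : ∀ s, c s < 0 := fun s => by
    have : min s 0 ≤ 0 := min_le_right _ _
    rw [hcdef]; linarith
  have hcle : ∀ s ≤ 0, c s = s + τ := fun s hs => by rw [hcdef, min_eq_left hs]; ring
  set S : Set (ℝ × EuclideanSpace ℝ (Fin 3)) := Iio 0 ×ˢ univ with hS
  have hcS : ∀ p : ℝ × EuclideanSpace ℝ (Fin 3), (c p.1, p.2) ∈ S := fun p => ⟨hcneg p.1, mem_univ _⟩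
  have hcpc : Continuous fun p : ℝ × EuclideanSpace ℝ (Fin 3) => ((c p.1, p.2) : ℝ × EuclideanSpace ℝ (Fin 3)) :=
    (hcc.comp continuous_fst).prodMk continuous_snd
  -- the objects (opaque names with defining equations)
  obtain ⟨F, hFdef⟩ : ∃ F : ℝ → EuclideanSpace ℝ (Fin 3) → ℝ, ∀ s, F s = f (c s) := ⟨_, fun _ => rfl⟩
  obtain ⟨b, hbdef⟩ : ∃ b : ℝ → EuclideanSpace ℝ (Fin 3) → EuclideanSpace ℝ (Fin 3), ∀ s, b s = u (c s) :=
    ⟨_, fun _ => rfl⟩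
  obtain ⟨Bst, hBdef⟩ : ∃ Bst : ℝ → EuclideanSpace ℝ (Fin 3) → EuclideanSpace ℝ (Fin 3), ∀ s, Bst s = B (c s) :=
    ⟨_, fun _ => rfl⟩
  obtain ⟨N, hNdef⟩ : ∃ N : ℝ → EuclideanSpace ℝ (Fin 3) → ℝ, ∀ s x, N s x =
      (Δ (F s)) x - fderiv ℝ (F s) x (b s x) - 2 / cylRadius x * fderiv ℝ (F s) x (eR x) := ⟨_, fun _ _ => rfl⟩
  -- joint continuity of `F`, `∇F`, `ΔF`
  have hFc : Continuous fun p : ℝ × EuclideanSpace ℝ (Fin 3) => F p.1 p.2 := by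
    have e : (fun p : ℝ × EuclideanSpace ℝ (Fin 3) => F p.1 p.2) = fun p => f (c p.1) p.2 :=
      funext fun p => by rw [hFdef]
    have h := hfc.comp_continuous hcpc hcS
    rw [e]; exact h
  have hDFc : Continuous fun p : ℝ × EuclideanSpace ℝ (Fin 3) => fderiv ℝ (F p.1) p.2 := by
    have e : (fun p : ℝ × EuclideanSpace ℝ (Fin 3) => fderiv ℝ (F p.1) p.2) = fun p => fderiv ℝ (f (c p.1)) p.2 :=
      funext fun p => by rw [hFdef]
    have h := h2.comp_continuous hcpc hcS
    rw [e]; exact h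
  have hΔFc : Continuous fun p : ℝ × EuclideanSpace ℝ (Fin 3) => (Δ (F p.1)) p.2 := by
    have e : (fun p : ℝ × EuclideanSpace ℝ (Fin 3) => (Δ (F p.1)) p.2) = fun p => (Δ (f (c p.1))) p.2 :=
      funext fun p => by rw [hFdef]
    have h := h3.comp_continuous hcpc hcS
    rw [e]; exact h
  have hgradFc : Continuous fun p : ℝ × EuclideanSpace ℝ (Fin 3) => gradient (F p.1) p.2 := by
    have : (fun p : ℝ × EuclideanSpace ℝ (Fin 3) => gradient (F p.1) p.2) =
        fun p => (InnerProductSpace.toDual ℝ (EuclideanSpace ℝ (Fin 3))).symm (fderiv ℝ (F p.1) p.2) := rfl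
    rw [this]
    exact (InnerProductSpace.toDual ℝ (EuclideanSpace ℝ (Fin 3))).symm.continuous.comp hDFc
  -- measurability of the drift and of `N`
  have hbmeas : Measurable fun p : ℝ × EuclideanSpace ℝ (Fin 3) => b p.1 p.2 := by
    have e : (fun p : ℝ × EuclideanSpace ℝ (Fin 3) => b p.1 p.2) = fun p => u (c p.1) p.2 :=
      funext fun p => by rw [hbdef]
    rw [e]; exact h7.comp hcpc.measurable
  have hNmeas : Measurable fun p : ℝ × EuclideanSpace ℝ (Fin 3) => N p.1 p.2 := by
    have e : (fun p : ℝ × EuclideanSpace ℝ (Fin 3) => N p.1 p.2) = fun p =>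
        (Δ (F p.1)) p.2 - ⟪gradient (F p.1) p.2, b p.1 p.2⟫ -
          2 / cylRadius p.2 * ⟪gradient (F p.1) p.2, eR p.2⟫ := by
      funext p
      rw [hNdef, inner_gradient_left, inner_gradient_left]
    rw [e]
    refine (hΔFc.measurable.sub (hgradFc.measurable.inner hbmeas)).sub ?_
    exact (measurable_const.div (continuous_cylRadius.measurable.comp measurable_snd)).mul
      (hgradFc.measurable.inner (measurable_eR.comp measurable_snd))
  have hbB : ∀ s, ∀ x ∈ closedBall (0 : EuclideanSpace ℝ (Fin 3)) R, ‖b s x‖ ≤ Cu :=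
    fun s x _ => by rw [hbdef]; exact hub _ (hcneg s) x
  have hCu0 : 0 ≤ Cu := (norm_nonneg _).trans (hub τ hτ 0)
  refine ⟨F, N, b, Bst, Cu, fun s hs x => by rw [hFdef, hcle s hs],
    fun s => by rw [hFdef]; exact h1 _ (hcneg s), fun s => by rw [hFdef]; exact h4 _ (hcneg s),
    fun s x hx => by rw [hFdef]; exact h5 _ (hcneg s) x hx,
    fun s => by rw [hbdef]; exact (h8 _ (hcneg s)).locallyIntegrable, ?_, hNdef, ?_, hFc, hgradFc,
    hNmeas.aestronglyMeasurable, ?_, hbmeas.aestronglyMeasurable, hbB⟩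
  · -- ### the stream function, for a.e. shifted time (translation invariance of Lebesgue measure)
    have hB' : ∀ᵐ t ∂(volume : Measure ℝ), t ∈ Iio (0 : ℝ) →
        Differentiable ℝ (B t) ∧ curl (B t) =ᵐ[volume] u t ∧ eBMOSeminormVec (B t) ≤ CB :=
      (ae_restrict_iff' measurableSet_Iio).1 hB
    have htr := (measurePreserving_add_right (volume : Measure ℝ) τ).quasiMeasurePreserving.ae hB'
    refine (ae_restrict_iff' measurableSet_Ioc).2 ?_
    filter_upwards [htr] with s hs hsI
    have h := hs (show s + τ ∈ Iio (0 : ℝ) by simp only [mem_Iio]; linarith [hsI.2])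
    rw [hBdef, hbdef, hcle s hsI.2]
    exact h
  · -- ### the integrated equation, for a.e. `x` (off the axis)
    have hax : ∀ᵐ x ∂(volume : Measure (EuclideanSpace ℝ (Fin 3))), cylRadius x ≠ 0 := by
      have h0 := volume_axis_eq_zero
      rw [ae_iff]
      refine measure_mono_null (fun x hx => ?_) h0
      simp only [mem_setOf_eq, not_not] at hx ⊢
      obtain ⟨hx0, hx1⟩ := (cylRadius_eq_zero_iff x).1 hx
      simp [hx0, hx1]
    filter_upwards [hax] with x hx
    -- the integrand of (5.10) at the point `x`, as a function of the (unshifted) time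
    obtain ⟨g, hg⟩ : ∃ g : ℝ → ℝ, ∀ t, g t = (Δ (f t)) x - fderiv ℝ (f t) x (u t x) -
        2 / cylRadius x * partialDeriv (eR x) (f t) x := ⟨_, fun _ => rfl⟩
    have hNg : ∀ σ, N σ x = g (c σ) := fun σ => by
      rw [hNdef, hg, hFdef, hbdef]; rfl
    -- `σ ↦ N σ x` is measurable and bounded on `[−R², 0]`, hence interval integrable
    have hNxm : Measurable fun σ => N σ x := hNmeas.comp (measurable_id.prodMk measurable_const)
    have hK : IsCompact ((Icc (-R ^ 2) (0 : ℝ)) ×ˢ ({x} : Set (EuclideanSpace ℝ (Fin 3)))) :=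
      isCompact_Icc.prod isCompact_singleton
    obtain ⟨A₁, hA₁⟩ := hK.exists_bound_of_continuousOn hΔFc.continuousOn
    obtain ⟨A₂, hA₂⟩ := hK.exists_bound_of_continuousOn hDFc.continuousOn
    have hR0 : -R ^ 2 ≤ (0 : ℝ) := by nlinarith
    have hA₂0 : 0 ≤ A₂ := (norm_nonneg _).trans (hA₂ (0, x) ⟨⟨hR0, le_rfl⟩, rfl⟩)
    have hNbd : ∀ σ ∈ Icc (-R ^ 2) (0 : ℝ), ‖N σ x‖ ≤ A₁ + A₂ * Cu + 2 / cylRadius x * A₂ := by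
      intro σ hσ
      have hp : ((σ, x) : ℝ × EuclideanSpace ℝ (Fin 3)) ∈ Icc (-R ^ 2) (0 : ℝ) ×ˢ ({x} : Set _) := ⟨hσ, rfl⟩
      have e1 := hA₁ (σ, x) hp
      have e2 := hA₂ (σ, x) hp
      have hr0 : 0 ≤ 2 / cylRadius x := div_nonneg zero_le_two (cylRadius_nonneg x)
      rw [Real.norm_eq_abs, hNdef]
      calc |(Δ (F σ)) x - fderiv ℝ (F σ) x (b σ x) - 2 / cylRadius x * fderiv ℝ (F σ) x (eR x)|
          ≤ |(Δ (F σ)) x| + |fderiv ℝ (F σ) x (b σ x)| + |2 / cylRadius x * fderiv ℝ (F σ) x (eR x)| := by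
            refine (abs_sub _ _).trans (add_le_add ((abs_sub _ _).trans le_rfl) le_rfl)
        _ ≤ A₁ + A₂ * Cu + 2 / cylRadius x * A₂ := by
            refine add_le_add (add_le_add ((Real.norm_eq_abs _).symm.le.trans e1) ?_) ?_
            · calc |fderiv ℝ (F σ) x (b σ x)| ≤ ‖fderiv ℝ (F σ) x‖ * ‖b σ x‖ := by
                    rw [← Real.norm_eq_abs]; exact ContinuousLinearMap.le_opNorm _ _
                _ ≤ A₂ * Cu := mul_le_mul e2 (by rw [hbdef]; exact hub _ (hcneg σ) x) (norm_nonneg _) hA₂0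
            · rw [abs_mul, abs_of_nonneg hr0]
              refine mul_le_mul_of_nonneg_left ?_ hr0
              calc |fderiv ℝ (F σ) x (eR x)| ≤ ‖fderiv ℝ (F σ) x‖ * ‖eR x‖ := by
                    rw [← Real.norm_eq_abs]; exact ContinuousLinearMap.le_opNorm _ _
                _ ≤ A₂ * 1 := mul_le_mul e2 (norm_eR_le_one x) (norm_nonneg _) hA₂0
                _ = A₂ := mul_one _
    have hNii : IntervalIntegrable (fun σ => N σ x) volume (-R ^ 2) 0 := by
      refine (intervalIntegrable_const (c := A₁ + A₂ * Cu + 2 / cylRadius x * A₂)).mono_fun'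
        hNxm.aestronglyMeasurable ?_
      rw [uIoc_of_le hR0]
      refine (ae_restrict_iff' measurableSet_Ioc).2 (ae_of_all _ fun σ hσ => ?_)
      exact hNbd σ (Ioc_subset_Icc_self hσ)
    refine ⟨hNii, fun s hs => ?_⟩
    -- the identity: shift (5.10) from `[−R² + τ, s + τ]` to `[−R², s]`
    have hs0 : s ≤ 0 := hs.2
    have hident := h11 x hx (-R ^ 2 + τ) (s + τ) (by linarith [hs.1]) (by linarith)
    have eg : (fun t => (Δ (f t)) x - fderiv ℝ (f t) x (u t x) - 2 / cylRadius x * partialDeriv (eR x) (f t) x) = g :=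
      funext fun t => (hg t).symm
    rw [eg] at hident
    have hshift : ∫ σ in (-R ^ 2)..s, N σ x = ∫ t in (-R ^ 2 + τ)..(s + τ), g t := by
      rw [← intervalIntegral.integral_comp_add_right g τ]
      refine intervalIntegral.integral_congr fun σ hσ => ?_
      rw [uIcc_of_le hs.1] at hσ
      show N σ x = g (σ + τ)
      rw [hNg, hcle σ (hσ.2.trans hs0)]
    rw [hshift, ← hident, hFdef, hFdef, hcle s hs0, hcle (-R ^ 2) hR0]
    ring
  · -- ### integrability of `N` on `(−R², 0] × B̄(0, R)` against `1 + 1/r`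
    set K : Set (EuclideanSpace ℝ (Fin 3)) := closedBall 0 R with hK
    have hKc : IsCompact K := isCompact_closedBall _ _
    have hcyl : IsCompact ((Icc (-R ^ 2) (0 : ℝ)) ×ˢ K) := isCompact_Icc.prod hKc
    obtain ⟨A₁, hA₁⟩ := hcyl.exists_bound_of_continuousOn hΔFc.continuousOn
    obtain ⟨A₂, hA₂⟩ := hcyl.exists_bound_of_continuousOn hDFc.continuousOn
    have hR0 : -R ^ 2 ≤ (0 : ℝ) := by nlinarith
    have h0K : (0 : EuclideanSpace ℝ (Fin 3)) ∈ K := mem_closedBall_self hR.le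
    have hA₁0 : 0 ≤ A₁ := (norm_nonneg _).trans (hA₁ (0, 0) ⟨⟨hR0, le_rfl⟩, h0K⟩)
    have hA₂0 : 0 ≤ A₂ := (norm_nonneg _).trans (hA₂ (0, 0) ⟨⟨hR0, le_rfl⟩, h0K⟩)
    have hf'i : Integrable ((univ ×ˢ K : Set (ℝ × EuclideanSpace ℝ (Fin 3))).indicator fun p => N p.1 p.2)
        ((volume.restrict (Ioc (-R ^ 2) 0)).prod volume) := by
      refine integrable_prod_of_le_mul_one_add_inv_cylRadius (K := K) hKc ?_ ?_
        (C := A₁ + A₂ * Cu + 2 * A₂) ?_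
      · exact (hNmeas.indicator (MeasurableSet.univ.prod hKc.measurableSet)).aestronglyMeasurable
      · intro s x hx
        rw [indicator_of_notMem (show (s, x) ∉ (univ ×ˢ K : Set _) from fun h => hx h.2)]
      · intro s hs x hx
        rw [indicator_of_mem (show (s, x) ∈ (univ ×ˢ K : Set _) from ⟨mem_univ _, hx⟩)]
        have hp : ((s, x) : ℝ × EuclideanSpace ℝ (Fin 3)) ∈ Icc (-R ^ 2) (0 : ℝ) ×ˢ K := ⟨Ioc_subset_Icc_self hs, hx⟩
        have e1 := hA₁ (s, x) hp
        have e2 := hA₂ (s, x) hp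
        have hr0 : 0 ≤ (cylRadius x)⁻¹ := inv_nonneg.2 (cylRadius_nonneg x)
        show |N s x| ≤ _
        rw [hNdef]
        calc |(Δ (F s)) x - fderiv ℝ (F s) x (b s x) - 2 / cylRadius x * fderiv ℝ (F s) x (eR x)|
            ≤ |(Δ (F s)) x| + |fderiv ℝ (F s) x (b s x)| + |2 / cylRadius x * fderiv ℝ (F s) x (eR x)| := by
              refine (abs_sub _ _).trans (add_le_add ((abs_sub _ _).trans le_rfl) le_rfl)
          _ ≤ A₁ + A₂ * Cu + 2 * (cylRadius x)⁻¹ * A₂ := by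
              refine add_le_add (add_le_add ((Real.norm_eq_abs _).symm.le.trans e1) ?_) ?_
              · calc |fderiv ℝ (F s) x (b s x)| ≤ ‖fderiv ℝ (F s) x‖ * ‖b s x‖ := by
                      rw [← Real.norm_eq_abs]; exact ContinuousLinearMap.le_opNorm _ _
                  _ ≤ A₂ * Cu := mul_le_mul e2 (by rw [hbdef]; exact hub _ (hcneg s) x) (norm_nonneg _) hA₂0
              · rw [abs_mul, div_eq_mul_inv, abs_of_nonneg (by positivity : (0 : ℝ) ≤ 2 * (cylRadius x)⁻¹)]
                refine mul_le_mul_of_nonneg_left ?_ (by positivity)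
                calc |fderiv ℝ (F s) x (eR x)| ≤ ‖fderiv ℝ (F s) x‖ * ‖eR x‖ := by
                      rw [← Real.norm_eq_abs]; exact ContinuousLinearMap.le_opNorm _ _
                  _ ≤ A₂ * 1 := mul_le_mul e2 (norm_eR_le_one x) (norm_nonneg _) hA₂0
                  _ = A₂ := mul_one _
          _ ≤ (A₁ + A₂ * Cu + 2 * A₂) * (1 + (cylRadius x)⁻¹) := by
              nlinarith [mul_nonneg hA₁0 hr0, mul_nonneg (mul_nonneg hA₂0 hCu0) hr0, hA₂0, hr0]
    -- from `1_K N` on `(−R², 0] × ℝ³` to `N` on `(−R², 0] × K`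
    rw [integrable_indicator_iff (MeasurableSet.univ.prod hKc.measurableSet)] at hf'i
    have hres : (((volume : Measure ℝ).restrict (Ioc (-R ^ 2) 0)).prod
        (volume : Measure (EuclideanSpace ℝ (Fin 3)))).restrict (univ ×ˢ K) =
        (volume.restrict (Ioc (-R ^ 2) 0)).prod (volume.restrict K) := by
      rw [← Measure.restrict_univ (μ := volume.restrict (Ioc (-R ^ 2) (0 : ℝ))), Measure.prod_restrict,
        Measure.restrict_univ]
    rw [IntegrableOn, hres] at hf'i
    exact hf'i

/-! ### Step 1 of the proof of Theorem 1.2: the oscillation decay forces `Γ ≡ 0` -/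

set_option maxHeartbeats 800000 in
-- the decay iteration over the cylinders `Q_τ(R)` (suprema/infima over compact cylinders)
/-- **Step 1 of the printed proof of Theorem 1.2** (Lei–Zhang 2011, p. 12: "By Theorem 1.1 …
Letting `L → ∞`, we find that `Γ(x,t) = Γ(0,0)` … we get that `u_θ = 0`"), in the tree's
form. In the swirl setting of `bundle_of_swirl_setting` with `|Γ| ≤ C`, `Γ ≡ 0`: for each apex
`τ < 0` the oscillation `J_τ(R)` of `Γ` over `[τ − R², τ] × B̄(0,R)` satisfies
`J_τ(θR) ≤ κ J_τ(R)` for all `R > 0` (`oscillation_step`, with `θ, κ < 1` depending only on the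
`BMO` bound) and `0 ≤ J_τ ≤ 2C`, hence `J_τ ≡ 0` (`eq_zero_of_forall_le_mul_of_bounded`): `Γ`
is constant on every such cylinder, and the cylinders meet the axis where `Γ = 0`. [cite: LeiZhang2011, proof of Thm. 1.2, step 1 (arXiv p. 12); (3.8)] -/
theorem swirl_setting_eq_zero
    {f : ℝ → EuclideanSpace ℝ (Fin 3) → ℝ} {u : ℝ → EuclideanSpace ℝ (Fin 3) → EuclideanSpace ℝ (Fin 3)}
    (h1 : ∀ t < 0, ContDiff ℝ 2 (f t))
    (hfc : ContinuousOn (fun p : ℝ × EuclideanSpace ℝ (Fin 3) => f p.1 p.2) (Iio 0 ×ˢ univ))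
    (h2 : ContinuousOn (fun p : ℝ × EuclideanSpace ℝ (Fin 3) => fderiv ℝ (f p.1) p.2) (Iio 0 ×ˢ univ))
    (h3 : ContinuousOn (fun p : ℝ × EuclideanSpace ℝ (Fin 3) => (Δ (f p.1)) p.2) (Iio 0 ×ˢ univ))
    (h4 : ∀ t < 0, IsAxisymmetricScalar (f t))
    (h5 : ∀ t < 0, ∀ x, cylRadius x = 0 → f t x = 0)
    {C : ℝ} (h6 : ∀ t < 0, ∀ x, |f t x| ≤ C)
    (h7 : Measurable (uncurry u)) (h8 : ∀ t < 0, Continuous (u t))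
    {Cu : ℝ} (hub : ∀ t < 0, ∀ x, ‖u t x‖ ≤ Cu)
    {B : ℝ → EuclideanSpace ℝ (Fin 3) → EuclideanSpace ℝ (Fin 3)} {CB : ℝ≥0}
    (hB : ∀ᵐ t ∂((volume : Measure ℝ).restrict (Iio 0)),
      Differentiable ℝ (B t) ∧ curl (B t) =ᵐ[volume] u t ∧ eBMOSeminormVec (B t) ≤ CB)
    (h11 : ∀ x, cylRadius x ≠ 0 → ∀ s t : ℝ, s ≤ t → t < 0 →
      f t x - f s x = ∫ τ in s..t, ((Δ (f τ)) x - fderiv ℝ (f τ) x (u τ x) -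
        2 / cylRadius x * partialDeriv (eR x) (f τ) x)) :
    ∀ t < 0, ∀ x, f t x = 0 := by
  obtain ⟨θ, κd, hθ0, hθ2, hκ0, hκ1, hosc⟩ := oscillation_step CB
  intro τ hτ
  -- the values of `Γ` over the cylinder `Q_τ(R)` and their oscillation
  set vals : ℝ → Set ℝ := fun R => (fun p : ℝ × EuclideanSpace ℝ (Fin 3) => f (p.1 + τ) p.2) ''
    (Icc (-R ^ 2) 0 ×ˢ closedBall (0 : EuclideanSpace ℝ (Fin 3)) R) with hvals
  set J : ℝ → ℝ := fun R => sSup (vals R) - sInf (vals R) with hJ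
  have hC0 : 0 ≤ C := (abs_nonneg _).trans (h6 τ hτ 0)
  have hne : ∀ R, 0 < R → (vals R).Nonempty := fun R hR =>
    ⟨_, ⟨(0, 0), ⟨⟨by nlinarith, le_rfl⟩, mem_closedBall_self hR.le⟩, rfl⟩⟩
  have hmemv : ∀ {R : ℝ} {v : ℝ}, v ∈ vals R → |v| ≤ C := by
    intro R v hv
    obtain ⟨p, hp, rfl⟩ := hv
    exact h6 _ (by linarith [hp.1.2]) _
  have hbddA : ∀ R, BddAbove (vals R) := fun R => ⟨C, fun v hv => (le_abs_self v).trans (hmemv hv)⟩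
  have hbddB : ∀ R, BddBelow (vals R) := fun R => ⟨-C, fun v hv => (neg_le.1 ((neg_le_abs v).trans (hmemv hv)))⟩
  have hsup_le : ∀ R, 0 < R → sSup (vals R) ≤ C := fun R hR =>
    csSup_le (hne R hR) fun v hv => (le_abs_self v).trans (hmemv hv)
  have hinf_ge : ∀ R, 0 < R → -C ≤ sInf (vals R) := fun R hR =>
    le_csInf (hne R hR) fun v hv => neg_le.1 ((neg_le_abs v).trans (hmemv hv))
  have hval_mem : ∀ {R : ℝ} (p : ℝ × EuclideanSpace ℝ (Fin 3)),
      p ∈ Icc (-R ^ 2) 0 ×ˢ closedBall (0 : EuclideanSpace ℝ (Fin 3)) R → f (p.1 + τ) p.2 ∈ vals R :=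
    fun p hp => ⟨p, hp, rfl⟩
  have hJ0 : ∀ R, 0 < R → 0 ≤ J R := fun R hR => by
    obtain ⟨v, hv⟩ := hne R hR
    have h := (csInf_le (hbddB R) hv).trans (le_csSup (hbddA R) hv)
    simp only [hJ]; linarith
  have hJM : ∀ R, 0 < R → J R ≤ 2 * C := fun R hR => by
    simp only [hJ]; linarith [hsup_le R hR, hinf_ge R hR]
  -- the decay `J(θR) ≤ κ J(R)`
  have hdecay : ∀ R, 0 < R → J (θ * R) ≤ κd * J R := by
    intro R hR
    obtain ⟨F, N, b, Bst, Mb, hFf, hF2, hFa, hF0, hb, hBst, hN, heq, hFc, hF1c, hNm, hNi, hbm, hbB⟩ :=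
      bundle_of_swirl_setting h1 hfc h2 h3 h4 h5 h7 h8 hub hB h11 hτ hR
    have hmM : ∀ s ∈ Icc (-R ^ 2) 0, ∀ x ∈ closedBall (0 : EuclideanSpace ℝ (Fin 3)) R,
        sInf (vals R) ≤ F s x ∧ F s x ≤ sSup (vals R) := by
      intro s hs x hx
      rw [hFf s hs.2 x]
      exact ⟨csInf_le (hbddB R) (hval_mem (s, x) ⟨hs, hx⟩), le_csSup (hbddA R) (hval_mem (s, x) ⟨hs, hx⟩)⟩
    have hstep := hosc hR hF2 hFa hF0 hb hBst hN heq hFc hF1c hNm hNi hbm hbB hmM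
    have hθR : 0 < θ * R := mul_pos hθ0 hR
    -- every two values over the small cylinder differ by at most `κ J(R)`
    have hpair : ∀ v ∈ vals (θ * R), ∀ w ∈ vals (θ * R), v - w ≤ κd * J R := by
      intro v hv w hw
      obtain ⟨p, hp, rfl⟩ := hv
      obtain ⟨q, hq, rfl⟩ := hw
      have e1 : f (p.1 + τ) p.2 = F p.1 p.2 := (hFf p.1 hp.1.2 p.2).symm
      have e2 : f (q.1 + τ) q.2 = F q.1 q.2 := (hFf q.1 hq.1.2 q.2).symm
      show f (p.1 + τ) p.2 - f (q.1 + τ) q.2 ≤ κd * J R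
      rw [e1, e2]
      exact hstep p hp q hq
    have h1' : sSup (vals (θ * R)) ≤ κd * J R + sInf (vals (θ * R)) := by
      refine csSup_le (hne _ hθR) fun v hv => ?_
      have : v - κd * J R ≤ sInf (vals (θ * R)) :=
        le_csInf (hne _ hθR) fun w hw => by linarith [hpair v hv w hw]
      linarith
    simp only [hJ] at h1' ⊢
    linarith
  have hJzero : ∀ R, 0 < R → J R = 0 := fun R hR =>
    eq_zero_of_forall_le_mul_of_bounded hθ0 hκ0 hκ1 hJ0 hJM hdecay hR
  -- conclusion: on every cylinder `Γ` is constant, equal to its value `0` on the axis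
  intro x
  set R : ℝ := ‖x‖ + 1 with hRdef
  have hR : 0 < R := by rw [hRdef]; positivity
  have hxR : x ∈ closedBall (0 : EuclideanSpace ℝ (Fin 3)) R := by
    rw [mem_closedBall_zero_iff, hRdef]; linarith
  have h0 := hJzero R hR
  have hv1 : f (0 + τ) x ∈ vals R := hval_mem (0, x) ⟨⟨by nlinarith, le_rfl⟩, hxR⟩
  have hv0 : f (0 + τ) 0 ∈ vals R := hval_mem (0, 0) ⟨⟨by nlinarith, le_rfl⟩, mem_closedBall_self hR.le⟩
  have heqv : ∀ v ∈ vals R, v = sInf (vals R) := by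
    intro v hv
    have ha := le_csSup (hbddA R) hv
    have hb := csInf_le (hbddB R) hv
    simp only [hJ] at h0
    linarith
  have hax : f τ 0 = 0 := h5 τ hτ 0 (by simp [cylRadius])
  rw [zero_add] at hv1 hv0
  rw [heqv _ hv1, ← heqv _ hv0, hax]

end LeiZhang2011

/-! ### Theorem 1.2 -/

open LeiZhang2011 in
/-- **Lei–Zhang 2011, Theorem 1.2 (the named fact `LeiZhang2011_liouville`), PROVED.** Let `u` be
a bounded weak, axisymmetric ancient solution of Navier–Stokes in `ℝ³ × (−∞, 0)` with
`|Γ| = |r u_θ| ≤ C` a.e. and a differentiable `BMO` stream function (`curl B(t) = u(t)` a.e.,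
`‖B(t)‖_BMO ≤ C` for a.e. `t`). Then `u ≡ 0`. Proof (p. 12): in the smooth setting
(`exists_setting`: KNSS 2009 §4 with (5.10)) the swirl `Γ = swirl U` is in the swirl setting with
the bounded drift `U + βe_z = curl B` (`∇Γ`, `ΔΓ` jointly continuous by the time-Lipschitz
bounds (4.8) and `fderiv_swirl_apply`, `laplacian_swirl`); by `swirl_setting_eq_zero` (the
oscillation decay (3.8) from Theorem 1.1, i.e. step 1) `Γ ≡ 0`, so `swirl u = 0` a.e.; steps 2–3
are `LeiZhang2011_liouville_of_swirl_step`. [cite: LeiZhang2011, Thm. 1.2 and its proof (arXiv p. 12)] -/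
theorem LeiZhang2011_liouville_holds : LeiZhang2011_liouville := by
  refine LeiZhang2011_liouville_of_swirl_step fun u hu haxi hΓ hB => ?_
  obtain ⟨U, β, B, C₀, Cst, hβm, ⟨Cβ, hCβ⟩, hUm, hrep, hsm, -, hax, hbd, hlip, hswirl, hΓbd, hBst⟩ :=
    exists_setting hu haxi hΓ hB
  set S : Set (ℝ × EuclideanSpace ℝ (Fin 3)) := Iio 0 ×ˢ univ with hS
  have hU2 : ∀ t < 0, ContDiff ℝ 2 (U t) := fun t ht => (hsm t ht).of_le (by norm_cast)
  have hU1 : ∀ t < 0, ContDiff ℝ 1 (U t) := fun t ht => (hsm t ht).of_le (by norm_cast)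
  have hUd : ∀ t < 0, ∀ x, DifferentiableAt ℝ (U t) x := fun t ht x =>
    ((hU1 t ht).differentiable one_ne_zero) x
  -- (4.8) ⇒ joint continuity of `U`, `∇U`, `∇²U` on `(−∞, 0) × ℝ³`
  have hD : ∀ k : ℕ, ContinuousOn (fun p : ℝ × EuclideanSpace ℝ (Fin 3) => iteratedFDeriv ℝ k (U p.1) p.2) S := by
    intro k
    obtain ⟨L, hL⟩ := hlip k
    exact continuousOn_iteratedFDeriv_of_lipschitz hsm hL
  have hUc : ContinuousOn (fun p : ℝ × EuclideanSpace ℝ (Fin 3) => U p.1 p.2) S := by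
    have h := (ContinuousMultilinearMap.apply ℝ (fun _ : Fin 0 => EuclideanSpace ℝ (Fin 3)) (EuclideanSpace ℝ (Fin 3))
      (Fin.elim0 : Fin 0 → EuclideanSpace ℝ (Fin 3))).continuous.comp_continuousOn (hD 0)
    refine h.congr fun p _ => ?_
    simp only [comp_apply, ContinuousMultilinearMap.apply_apply, iteratedFDeriv_zero_apply]
  have hD1c : ∀ y : EuclideanSpace ℝ (Fin 3),
      ContinuousOn (fun p : ℝ × EuclideanSpace ℝ (Fin 3) => fderiv ℝ (U p.1) p.2 y) S := by
    intro y
    have h := (ContinuousMultilinearMap.apply ℝ (fun _ : Fin 1 => EuclideanSpace ℝ (Fin 3)) (EuclideanSpace ℝ (Fin 3))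
      (fun _ => y)).continuous.comp_continuousOn (hD 1)
    refine h.congr fun p _ => ?_
    simp only [comp_apply, ContinuousMultilinearMap.apply_apply, iteratedFDeriv_one_apply]
  have hD2c : ∀ m : Fin 2 → EuclideanSpace ℝ (Fin 3),
      ContinuousOn (fun p : ℝ × EuclideanSpace ℝ (Fin 3) => iteratedFDeriv ℝ 2 (U p.1) p.2 m) S := fun m =>
    (ContinuousMultilinearMap.apply ℝ (fun _ : Fin 2 => EuclideanSpace ℝ (Fin 3)) (EuclideanSpace ℝ (Fin 3)) m).continuous.comp_continuousOn
      (hD 2)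
  -- the swirl `Γ = swirl U` and its derivatives are jointly continuous
  have hfc : ContinuousOn (fun p : ℝ × EuclideanSpace ℝ (Fin 3) => swirl (U p.1) p.2) S := by
    have hx0 : Continuous fun p : ℝ × EuclideanSpace ℝ (Fin 3) => p.2 0 :=
      (PiLp.continuous_apply 2 _ 0).comp continuous_snd
    have hx1 : Continuous fun p : ℝ × EuclideanSpace ℝ (Fin 3) => p.2 1 :=
      (PiLp.continuous_apply 2 _ 1).comp continuous_snd
    have hU0 : ContinuousOn (fun p : ℝ × EuclideanSpace ℝ (Fin 3) => U p.1 p.2 0) S :=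
      (PiLp.continuous_apply 2 _ 0).comp_continuousOn hUc
    have hU1 : ContinuousOn (fun p : ℝ × EuclideanSpace ℝ (Fin 3) => U p.1 p.2 1) S :=
      (PiLp.continuous_apply 2 _ 1).comp_continuousOn hUc
    simp only [swirl]
    exact (hx0.continuousOn.mul hU1).sub (hx1.continuousOn.mul hU0)
  have h2 : ContinuousOn (fun p : ℝ × EuclideanSpace ℝ (Fin 3) => fderiv ℝ (swirl (U p.1)) p.2) S := by
    refine continuousOn_clm_apply.2 fun y => ?_
    have hG : ContinuousOn
        (fun p : ℝ × EuclideanSpace ℝ (Fin 3) => ⟪rotGen p.2, fderiv ℝ (U p.1) p.2 y⟫ + ⟪rotGen y, U p.1 p.2⟫) S :=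
      ((rotGenL.continuous.comp continuous_snd).continuousOn.inner (hD1c y)).add
        (continuousOn_const.inner hUc)
    refine hG.congr fun p hp => ?_
    exact fderiv_swirl_apply (hUd p.1 hp.1 p.2) y
  have h3 : ContinuousOn (fun p : ℝ × EuclideanSpace ℝ (Fin 3) => (Δ (swirl (U p.1))) p.2) S := by
    classical
    set bb := EuclideanSpace.basisFun (Fin 3) ℝ with hbb
    have hΔU : ContinuousOn (fun p : ℝ × EuclideanSpace ℝ (Fin 3) => (Δ (U p.1)) p.2) S := by
      have h : ContinuousOn
          (fun p : ℝ × EuclideanSpace ℝ (Fin 3) => ∑ i, iteratedFDeriv ℝ 2 (U p.1) p.2 ![bb i, bb i]) S :=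
        continuousOn_finsetSum _ fun i _ => hD2c _
      refine h.congr fun p _ => ?_
      exact congrFun (laplacian_eq_iteratedFDeriv_orthonormalBasis (U p.1) bb) p.2
    have hG : ContinuousOn (fun p : ℝ × EuclideanSpace ℝ (Fin 3) => ⟪rotGen p.2, (Δ (U p.1)) p.2⟫ +
        2 * (fderiv ℝ (U p.1) p.2 (EuclideanSpace.single 0 1) 1 -
          fderiv ℝ (U p.1) p.2 (EuclideanSpace.single 1 1) 0)) S :=
      ((rotGenL.continuous.comp continuous_snd).continuousOn.inner hΔU).add
        (continuousOn_const.mul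
          (((PiLp.continuous_apply 2 _ 1).comp_continuousOn (hD1c _)).sub
            ((PiLp.continuous_apply 2 _ 0).comp_continuousOn (hD1c _))))
    refine hG.congr fun p hp => ?_
    exact laplacian_swirl (hU2 p.1 hp.1) p.2
  -- the drift `U + β e_z`: measurable, continuous bounded slices
  obtain ⟨CU, hCU⟩ := hbd 0
  have hub : ∀ t < 0, ∀ x, ‖U t x + β t • eZ‖ ≤ CU + Cβ := by
    intro t ht x
    have h1 := hCU t ht x
    rw [norm_iteratedFDeriv_zero] at h1
    calc ‖U t x + β t • eZ‖ ≤ ‖U t x‖ + ‖β t • eZ‖ := norm_add_le _ _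
      _ ≤ CU + Cβ := by
          refine add_le_add h1 ?_
          rw [norm_smul, Real.norm_eq_abs]
          calc |β t| * ‖eZ‖ ≤ Cβ * 1 := by
                refine mul_le_mul (hCβ t) ?_ (norm_nonneg _) ((abs_nonneg _).trans (hCβ t))
                simp [eZ]
            _ = Cβ := mul_one _
  have hzero := swirl_setting_eq_zero (f := fun t x => swirl (U t) x) (u := fun t x => U t x + β t • eZ)
    (fun t ht => contDiff_swirl (hU2 t ht)) hfc h2 h3
    (fun t ht => (hax t ht).isAxisymmetricScalar_swirl)
    (fun t _ x hx => swirl_eq_zero_of_cylRadius_eq_zero _ hx) hΓbd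
    (show Measurable fun p : ℝ × EuclideanSpace ℝ (Fin 3) => U p.1 p.2 + β p.1 • eZ from
      hUm.add ((hβm.comp measurable_fst).smul_const eZ))
    (fun t ht => (hsm t ht).continuous.add continuous_const) hub hBst hswirl
  -- transfer to `u = U + β e_z` (a.e.)
  filter_upwards [hrep, ae_restrict_mem measurableSet_Iio] with t ht htneg
  filter_upwards [ht] with x hx
  have h0 := hzero t htneg x
  rw [show swirl (u t) x = swirl (fun y => U t y + β t • eZ) x by simp [swirl, hx], swirl_add_smul_eZ]
  exact h0

end Literature.Analysis.FluidPDE
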